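import Summits.QuantumFields.YangMills.Theorems.UnitScaleTiltProp7CovKernelMemberBondData
import Summits.QuantumFields.YangMills.Theorems.UnitScaleTiltProp7TransplantGen0Arithmetic
import Summits.QuantumFields.YangMills.Theorems.UnitScaleTiltProp7CovPinJunkSums
import HarnessLib

/-!
# Route `UnitScaleTilt`, crux K1 «MinimiserStabilityRegPr» (stmt-QuantumFields-19200), route-R E′ path (α′), (E1-b) at the CURVED background — (A-cov) MEMBER, «GEN-0 HALF»:
# AT THE MEMBER OF RECORD, FOR EVERY BOND POLE `x₀`, DIRECTION `μ₀` AND CHARGE `X`: THE FRAME∕WEIGHT BOND DATA (✓ `exists_member_bond_data`), THE gen-0 PACKAGE (✓ `exists_gen0_package`: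
# `ψ g c₁ c₂ ψt`, the two flat identities, the near datum, the five gen-0 numbers `N2₀ H₀ S₀ N3₀ N4₀`, gen-1's input rows for `E₂`), THE SIZE OF THE JUNK DENSITY LETTER `B·ℓ_k² ≤ (32α + 400α²)·C`,
# AND THE gen-0 HALF OF `htot`: `N2₀ + N3₀ + W₀·3N4₀ + W₀·(3H₀ + 5A·S₀) ≤ c₀·ℓ_k·√hs X` FOR EVERY POINCARÉ CONSTANT `0 ≤ A ≤ c_A·ℓ_k²` (✓ `gen0_total_le` at `d = 3`, `N = 2`,
# `W₀ = (5∕κ)√(5∕κ)·ℓ_k√ℓ_k`, `Ω = e^{11κ}`), `c₀ = c₀(C, α, κ, c_A)` FREE OF THE MEMBER.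

Cell `ym3-torus`, width seat `ym3-torus-px22` (gen 3).  So the (A-cov) MEMBER THEOREM is: this file (gen-0 half) + the gen-1 package∕arithmetic + ✓ `htr_body_of_rows'''` + ✓ `hKsup_of_transplant_T3'`.
THEOREMS ONLY (0 `def`, 0 `sorry`); `--supports stmt-QuantumFields-19200`, count-neutral.  YM₃ on T³ is a ladder rung (R3), not the Clay problem; nothing here claims the stub, the crux, d = 4 or the gap.

References: T. Bałaban, CMP 99 (1985) 389–434 [Balaban1985BackgroundPropagators] ((3.8) p.392, (3.28) p.395, (3.35) p.396); CMP 96 (1984) 223–250 [Balaban1984PropagatorsII] ((1.9) p.226, (2.61) p.234);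
CMP 99 (1985) 75–102 [Balaban1985RegularSpaces] ((1.14) p.78, (1.36) p.82).
-/

set_option autoImplicit false

noncomputable section

open scoped BigOperators Matrix.Norms.L2Operator Matrix
open Finset

namespace Summit.QuantumFields.YangMills.Theorems.Prop7CovKernelMemberGen0

open Literature.MathematicalPhysics.QuantumFieldTheory.Balaban1983to89
open Literature.MathematicalPhysics.QuantumFieldTheory.Balaban1983to89.T3ContinuumYM3Torus
open Literature.MathematicalPhysics.QuantumFieldTheory.Balaban1983to89.T3PrintedRegularMinimiser (RegPr)
open Literature.MathematicalPhysics.QuantumFieldTheory.Balaban1983to89.B6GlobalChartV1 (PV)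
open B9Eq39Adjoint (covD divB)
open B9TorusCalculus (torusT)
open B15DeterminingSets (embIter)
open B10Eq27TorusAxialLog (unitsField toUField)
open Summit.QuantumFields.YangMills.Theorems.Prop7SectET3Members (hd3 hkw)
open Summit.QuantumFields.YangMills.Theorems.Prop7CovKernelMemberBondData (exists_member_bond_data)
open Summit.QuantumFields.YangMills.Theorems.Prop7TransplantGen0Package (exists_gen0_package)
open Summit.QuantumFields.YangMills.Theorems.Prop7TransplantGen0Arithmetic (gen0_total_le junk_B_le)
open Summit.QuantumFields.YangMills.Theorems.Prop7TransplantGen0Numbers (card_ball_le)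
open Summit.QuantumFields.YangMills.Theorems.Prop7CovPinJunkSums (norm_le_sqrt_hs)

variable {ℓ : ℕ} {hL : Odd (ℓ + 1) ∧ 1 < ℓ + 1}

/-- ★★★ **THE gen-0 HALF OF THE (A-cov) MEMBER THEOREM** (see the module docstring): constants `a₅ α C` (smallness, cone-letter size, package constant), then for every `c_A ≥ 0` and Agmon
rate `0 < κ ≤ 1` a constant `c₀ ≥ 0`, then at every member and pole `x₀`: the bond data `Fr ω A₀ A₁ A₂` with all its rows, and for every `μ₀ X` the gen-0 package with its five numbers,
gen-1's `E₂` rows, the size of `B`, and `N2₀ + N3₀ + W₀·3N4₀ + W₀(3H₀ + 5A·S₀) ≤ c₀·ℓ_k·√hs X` for every `0 ≤ A ≤ c_A·ℓ_k²`.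
[cite: Balaban1985BackgroundPropagators, (3.8) p.392, (3.35) p.396; Balaban1984PropagatorsII, (1.9) p.226; Balaban1985RegularSpaces, (1.36) p.82] -/
theorem exists_member_gen0_half (hℓ4 : 4 ≤ ℓ) : ∃ a₅ α C : ℝ, 0 < a₅ ∧ 0 ≤ α ∧ 0 ≤ C ∧
    ∀ (cA κ : ℝ), 0 ≤ cA → 0 < κ → κ ≤ 1 → ∃ c₀ : ℝ, 0 ≤ c₀ ∧
    ∀ (hℓ : 4 ≤ ℓ) (m : ℕ) (hm : 1 ≤ m) (n K a' R : ℕ) (hk1 : 1 ≤ K - n) (hsize : a' + 3 ≤ m + n) (hM8 : 8 ≤ (ℓ + 1) ^ a')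
      (hR2 : 2 * (ℓ + 1) ^ 2 ≤ R) (α₀ : ℝ), 0 < α₀ → ((ℓ + 1 : ℕ) : ℝ) * (((ℓ + 1) ^ a' : ℕ) : ℝ) * α₀ ≤ a₅ →
      ∀ W : GaugeField (PV 2 ℓ m K hd3 hL) 0 (Matrix.specialUnitaryGroup (Fin 2) ℂ),
        RegPr (⟨ℓ + 1, hL, m, hm⟩ : T3Family) n K α₀ W →
        ∀ (x₀ : Site (PV 2 ℓ m K hd3 hL) 0),
          ∃ (Fr : Site (PV 2 ℓ m K hd3 hL) 0 → (Matrix (Fin 2) (Fin 2) ℂ)ˣ) (ω : Site (PV 2 ℓ m K hd3 hL) 0 → ℝ) (A₀ A₁ A₂ : ℝ),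
            -- the bond data (✓ `exists_member_bond_data`, verbatim)
            (∀ (κ' : Fin (PV 2 ℓ m K hd3 hL).d) (y : Site (PV 2 ℓ m K hd3 hL) 0), ‖(unitsField (toUField W) ⟨y, κ'⟩ : Matrix (Fin 2) (Fin 2) ℂ)‖ ≤ 1 ∧
              ‖(((unitsField (toUField W) ⟨y, κ'⟩)⁻¹ : (Matrix (Fin 2) (Fin 2) ℂ)ˣ) : Matrix (Fin 2) (Fin 2) ℂ)‖ ≤ 1) ∧
            (∀ z : Site (PV 2 ℓ m K hd3 hL) 0, ‖(Fr z : Matrix (Fin 2) (Fin 2) ℂ)‖ ≤ 1 ∧ ‖(((Fr z)⁻¹ : (Matrix (Fin 2) (Fin 2) ℂ)ˣ) : Matrix (Fin 2) (Fin 2) ℂ)‖ ≤ 1) ∧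
            Fr x₀ = 1 ∧
            (∀ μ : Fin (PV 2 ℓ m K hd3 hL).d, Fr (torusT (PV 2 ℓ m K hd3 hL) 0 μ x₀) = (unitsField (toUField W) ⟨x₀, μ⟩)⁻¹) ∧
            0 ≤ A₀ ∧ 0 ≤ A₁ ∧ 0 ≤ A₂ ∧
            (∀ z ∈ (univ.filter fun z : Site (PV 2 ℓ m K hd3 hL) 0 => Site.tdist z x₀ ≤ 9 * (PV 2 ℓ m K hd3 hL).L ^ (K - n) + (PV 2 ℓ m K hd3 hL).L ^ (K - n)),
              ∀ μ : Fin (PV 2 ℓ m K hd3 hL).d,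
              ‖(((Fr z)⁻¹ * unitsField (toUField W) ⟨z, μ⟩ * Fr (torusT (PV 2 ℓ m K hd3 hL) 0 μ z) : (Matrix (Fin 2) (Fin 2) ℂ)ˣ) : Matrix (Fin 2) (Fin 2) ℂ) - 1‖
                ≤ A₁ * ((Site.tdist z x₀ : ℝ) + 1)) ∧
            (∀ z ∈ (univ.filter fun z : Site (PV 2 ℓ m K hd3 hL) 0 => Site.tdist z x₀ ≤ 9 * (PV 2 ℓ m K hd3 hL).L ^ (K - n) + (PV 2 ℓ m K hd3 hL).L ^ (K - n)),
              ∀ μ : Fin (PV 2 ℓ m K hd3 hL).d,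
              ‖(((Fr ((torusT (PV 2 ℓ m K hd3 hL) 0 μ).symm z))⁻¹ * unitsField (toUField W) ⟨(torusT (PV 2 ℓ m K hd3 hL) 0 μ).symm z, μ⟩
                  * Fr (torusT (PV 2 ℓ m K hd3 hL) 0 μ ((torusT (PV 2 ℓ m K hd3 hL) 0 μ).symm z)) : (Matrix (Fin 2) (Fin 2) ℂ)ˣ) : Matrix (Fin 2) (Fin 2) ℂ) - 1‖
                ≤ A₁ * ((Site.tdist z x₀ : ℝ) + 1)) ∧
            (∀ z ∈ (univ.filter fun z : Site (PV 2 ℓ m K hd3 hL) 0 => Site.tdist z x₀ ≤ 9 * (PV 2 ℓ m K hd3 hL).L ^ (K - n) + (PV 2 ℓ m K hd3 hL).L ^ (K - n)),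
              ∀ μ : Fin (PV 2 ℓ m K hd3 hL).d,
              ‖(((Fr z)⁻¹ * unitsField (toUField W) ⟨z, μ⟩ * Fr (torusT (PV 2 ℓ m K hd3 hL) 0 μ z) : (Matrix (Fin 2) (Fin 2) ℂ)ˣ) : Matrix (Fin 2) (Fin 2) ℂ)
                - (((Fr ((torusT (PV 2 ℓ m K hd3 hL) 0 μ).symm z))⁻¹ * unitsField (toUField W) ⟨(torusT (PV 2 ℓ m K hd3 hL) 0 μ).symm z, μ⟩
                  * Fr (torusT (PV 2 ℓ m K hd3 hL) 0 μ ((torusT (PV 2 ℓ m K hd3 hL) 0 μ).symm z)) : (Matrix (Fin 2) (Fin 2) ℂ)ˣ) : Matrix (Fin 2) (Fin 2) ℂ)‖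
                ≤ A₀ + A₂ * ((Site.tdist z x₀ : ℝ) + 2)) ∧
            A₁ * ((((ℓ + 1 : ℕ) : ℝ) ^ (K - n)) ^ 2) ≤ α ∧ A₀ * ((((ℓ + 1 : ℕ) : ℝ) ^ (K - n)) ^ 2) ≤ α ∧ A₂ * ((((ℓ + 1 : ℕ) : ℝ) ^ (K - n)) ^ 3) ≤ α ∧
            (∀ z, 0 < ω z) ∧
            (∀ z ν, |ω (z.shift ν) - ω z| ≤ (2 * κ / (((ℓ + 1 : ℕ) : ℝ) ^ (K - n))) * ω z ∧ |ω (z.unshift ν) - ω z| ≤ (2 * κ / (((ℓ + 1 : ℕ) : ℝ) ^ (K - n))) * ω z) ∧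
            (∀ z ν, |ω (z.shift ν) + ω (z.unshift ν) - 2 * ω z| ≤ (4 * κ / (((ℓ + 1 : ℕ) : ℝ) ^ (K - n)) ^ 2) * ω z) ∧
            Real.sqrt (∑ z, (ω z)⁻¹ ^ 2) ≤ 5 / κ * Real.sqrt (5 / κ) * (((ℓ + 1 : ℕ) : ℝ) ^ (K - n)) * Real.sqrt (((ℓ + 1 : ℕ) : ℝ) ^ (K - n)) ∧
            (∀ z ∈ (univ.filter fun z : Site (PV 2 ℓ m K hd3 hL) 0 => Site.tdist z x₀ ≤ 9 * (PV 2 ℓ m K hd3 hL).L ^ (K - n) + (PV 2 ℓ m K hd3 hL).L ^ (K - n)),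
              0 ≤ ω z ∧ ω z ≤ Real.exp (11 * κ)) ∧
            -- the gen-0 package of every bond charge
            ∀ (μ₀ : Fin (PV 2 ℓ m K hd3 hL).d) (X : Matrix (Fin 2) (Fin 2) ℂ),
              ∃ (ψ g c₁ c₂ ψt : Site (PV 2 ℓ m K hd3 hL) 0 → ℝ) (N2₀ N3₀ N4₀ H₀ S₀ : ℝ),
                (∀ z, ∑ ν : Fin (PV 2 ℓ m K hd3 hL).d, (2 * ψ z - ψ (torusT (PV 2 ℓ m K hd3 hL) 0 ν z) - ψ ((torusT (PV 2 ℓ m K hd3 hL) 0 ν).symm z)) = g z + c₁ z) ∧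
                (∀ z, ∑ ν : Fin (PV 2 ℓ m K hd3 hL).d, (2 * g z - g (torusT (PV 2 ℓ m K hd3 hL) 0 ν z) - g ((torusT (PV 2 ℓ m K hd3 hL) 0 ν).symm z))
                  = ((if z = x₀.shift μ₀ then (1 : ℝ) else 0) - (if z = x₀ then (1 : ℝ) else 0)) + c₂ z) ∧
                (∀ y ∈ Set.range (embIter (P := PV 2 ℓ m K hd3 hL) (K - n)), ψt y = ψ y) ∧
                (∑ z, Real.sqrt (∑ j : Fin 2, ∑ k' : Fin 2, ‖(divB (torusT (PV 2 ℓ m K hd3 hL) 0) (fun κ z => unitsField (toUField W) ⟨z, κ⟩)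
                  (fun μ => covD (torusT (PV 2 ℓ m K hd3 hL) 0) (fun κ z => unitsField (toUField W) ⟨z, κ⟩) μ (fun y => ψ y • B9Eq39Adjoint.R (Fr y) X)) z) j k'‖ ^ 2) ≤ N2₀) ∧
                (∀ E₁ : Site (PV 2 ℓ m K hd3 hL) 0 → Matrix (Fin 2) (Fin 2) ℂ,
                  (∀ z, E₁ z = divB (torusT (PV 2 ℓ m K hd3 hL) 0) (fun κ z => unitsField (toUField W) ⟨z, κ⟩)
                      (fun μ => covD (torusT (PV 2 ℓ m K hd3 hL) 0) (fun κ z => unitsField (toUField W) ⟨z, κ⟩) μ (fun y => ψ y • B9Eq39Adjoint.R (Fr y) X)) z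
                    - (∑ ν : Fin (PV 2 ℓ m K hd3 hL).d, (2 * ψ z - ψ (torusT (PV 2 ℓ m K hd3 hL) 0 ν z) - ψ ((torusT (PV 2 ℓ m K hd3 hL) 0 ν).symm z))) • B9Eq39Adjoint.R (Fr z) X) →
                  Real.sqrt (∑ z, ω z ^ 2 * ∑ j : Fin 2, ∑ k' : Fin 2, ‖(E₁ z + c₁ z • B9Eq39Adjoint.R (Fr z) X) j k'‖ ^ 2) ≤ H₀) ∧
                Real.sqrt (∑ z, ω z ^ 2 * ∑ j : Fin 2, ∑ k' : Fin 2, ‖(c₂ z • B9Eq39Adjoint.R (Fr z) X) j k'‖ ^ 2) ≤ S₀ ∧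
                (∑ z, Real.sqrt (∑ j : Fin 2, ∑ k' : Fin 2, ‖(divB (torusT (PV 2 ℓ m K hd3 hL) 0) (fun κ z => unitsField (toUField W) ⟨z, κ⟩)
                  (fun μ => covD (torusT (PV 2 ℓ m K hd3 hL) 0) (fun κ z => unitsField (toUField W) ⟨z, κ⟩) μ (fun y => ψt y • B9Eq39Adjoint.R (Fr y) X)) z) j k'‖ ^ 2) ≤ N3₀) ∧
                Real.sqrt (∑ z, ω z ^ 2 * ∑ j : Fin 2, ∑ k' : Fin 2, ‖(divB (torusT (PV 2 ℓ m K hd3 hL) 0) (fun κ z => unitsField (toUField W) ⟨z, κ⟩)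
                  (fun μ => covD (torusT (PV 2 ℓ m K hd3 hL) 0) (fun κ z => unitsField (toUField W) ⟨z, κ⟩) μ (fun y => ψt y • B9Eq39Adjoint.R (Fr y) X)) z) j k'‖ ^ 2) ≤ N4₀ ∧
                -- gen-1's input: the density and vanishing of `E₂` (✓ `exists_gen0_package`, verbatim), and the size of its letter `B`
                (∀ E₂ : Site (PV 2 ℓ m K hd3 hL) 0 → Matrix (Fin 2) (Fin 2) ℂ,
                  (∀ z, E₂ z = divB (torusT (PV 2 ℓ m K hd3 hL) 0) (fun κ z => unitsField (toUField W) ⟨z, κ⟩)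
                      (fun μ => covD (torusT (PV 2 ℓ m K hd3 hL) 0) (fun κ z => unitsField (toUField W) ⟨z, κ⟩) μ (fun y => g y • B9Eq39Adjoint.R (Fr y) X)) z
                    - (∑ ν : Fin (PV 2 ℓ m K hd3 hL).d, (2 * g z - g (torusT (PV 2 ℓ m K hd3 hL) 0 ν z) - g ((torusT (PV 2 ℓ m K hd3 hL) 0 ν).symm z))) • B9Eq39Adjoint.R (Fr z) X) →
                  (∀ z ∈ (univ.filter fun z : Site (PV 2 ℓ m K hd3 hL) 0 => Site.tdist z x₀ ≤ 9 * (PV 2 ℓ m K hd3 hL).L ^ (K - n)),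
                    ‖E₂ z‖ ≤ (PV 2 ℓ m K hd3 hL).d * (((2 * (A₀ + A₂ * (9 * ((PV 2 ℓ m K hd3 hL).L ^ (K - n) : ℕ) + 2)) + 4 * (A₁ * (9 * ((PV 2 ℓ m K hd3 hL).L ^ (K - n) : ℕ) + 1)) ^ 2) * C
                      + 8 * A₁ * C) / (max 1 ((Site.tdist z x₀ : ℕ) : ℝ)) ^ 2) * ‖X‖) ∧
                  (∀ z ∉ (univ.filter fun z : Site (PV 2 ℓ m K hd3 hL) 0 => Site.tdist z x₀ ≤ 9 * (PV 2 ℓ m K hd3 hL).L ^ (K - n)), E₂ z = 0)) ∧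
                ((2 * (A₀ + A₂ * (9 * (((PV 2 ℓ m K hd3 hL).L ^ (K - n) : ℕ) : ℝ) + 2)) + 4 * (A₁ * (9 * (((PV 2 ℓ m K hd3 hL).L ^ (K - n) : ℕ) : ℝ) + 1)) ^ 2) * C + 8 * A₁ * C)
                    * (((PV 2 ℓ m K hd3 hL).L ^ (K - n) : ℕ) : ℝ) ^ 2 ≤ (32 * α + 400 * α ^ 2) * C ∧
                -- the gen-0 half of `htot`
                ∀ A : ℝ, 0 ≤ A → A ≤ cA * (((ℓ + 1 : ℕ) : ℝ) ^ (K - n)) ^ 2 →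
                  N2₀ + N3₀ + 5 / κ * Real.sqrt (5 / κ) * (((ℓ + 1 : ℕ) : ℝ) ^ (K - n)) * Real.sqrt (((ℓ + 1 : ℕ) : ℝ) ^ (K - n)) * (3 * N4₀)
                    + 5 / κ * Real.sqrt (5 / κ) * (((ℓ + 1 : ℕ) : ℝ) ^ (K - n)) * Real.sqrt (((ℓ + 1 : ℕ) : ℝ) ^ (K - n)) * (3 * H₀ + 5 * A * S₀)
                    ≤ c₀ * ((ℓ + 1 : ℕ) : ℝ) ^ (K - n) * Real.sqrt (∑ j : Fin 2, ∑ k' : Fin 2, ‖X j k'‖ ^ 2) := by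
  obtain ⟨c35, a₅, hc35, ha₅, HB⟩ := exists_member_bond_data (hL := hL) hℓ4
  obtain ⟨C, hC, HP⟩ := exists_gen0_package
  refine ⟨a₅, c35 * a₅ * Real.exp (c35 * a₅) * (1 + 4 * (c35 * a₅ * Real.exp (c35 * a₅))), C, ha₅, by positivity, hC, ?_⟩
  intro cA κ hcA hκ0 hκ1
  have hw0 : (0 : ℝ) ≤ 5 / κ * Real.sqrt (5 / κ) := by positivity
  have hΩ0 : (0 : ℝ) ≤ Real.exp (11 * κ) := (Real.exp_pos _).le
  have hα0 : (0 : ℝ) ≤ c35 * a₅ * Real.exp (c35 * a₅) * (1 + 4 * (c35 * a₅ * Real.exp (c35 * a₅))) := by positivity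
  refine ⟨C * (9737 + 24000 * Real.sqrt (2 : ℕ) * (32 * (c35 * a₅ * Real.exp (c35 * a₅) * (1 + 4 * (c35 * a₅ * Real.exp (c35 * a₅)))) + 400 * (c35 * a₅ * Real.exp (c35 * a₅) * (1 + 4 * (c35 * a₅ * Real.exp (c35 * a₅)))) ^ 2)
      + (10648 + 312 * (5 / κ * Real.sqrt (5 / κ)) * Real.exp (11 * κ))
        * (27 * (10 * Real.sqrt 3 + 6) ^ 2 + 3 * Real.sqrt (2 : ℕ) * (26 * (c35 * a₅ * Real.exp (c35 * a₅) * (1 + 4 * (c35 * a₅ * Real.exp (c35 * a₅))))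
          + 484 * (c35 * a₅ * Real.exp (c35 * a₅) * (1 + 4 * (c35 * a₅ * Real.exp (c35 * a₅)))) ^ 2 + 66 * (10 * Real.sqrt 3 + 6) * (c35 * a₅ * Real.exp (c35 * a₅) * (1 + 4 * (c35 * a₅ * Real.exp (c35 * a₅))))))
      + 270 * (5 / κ * Real.sqrt (5 / κ)) * Real.exp (11 * κ) * (3 * Real.sqrt (2 : ℕ) * (32 * (c35 * a₅ * Real.exp (c35 * a₅) * (1 + 4 * (c35 * a₅ * Real.exp (c35 * a₅))))
          + 400 * (c35 * a₅ * Real.exp (c35 * a₅) * (1 + 4 * (c35 * a₅ * Real.exp (c35 * a₅)))) ^ 2) + 1)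
      + 450 * (5 / κ * Real.sqrt (5 / κ)) * cA * Real.exp (11 * κ)), by positivity, ?_⟩
  intro hℓ m hm n K a' R hk1 hsize hM8 hR2 α₀ hα₀ hMα W hreg x₀
  obtain ⟨Fr, ω, A₀, A₁, A₂, hU, hFr, hFr1, hpole, hA₀0, hA₁0, hA₂0, h1, h1', h2, hA₁, hA₀, hA₂, hω₀, hω₁, hω₂, hcount, hωS⟩ :=
    HB hℓ m hm n K a' R hk1 hsize hM8 hR2 α₀ hα₀ hMα W hreg x₀ κ hκ0 hκ1
  refine ⟨Fr, ω, A₀, A₁, A₂, hU, hFr, hFr1, hpole, hA₀0, hA₁0, hA₂0, h1, h1', h2, hA₁, hA₀, hA₂, hω₀, hω₁, hω₂, hcount, hωS, ?_⟩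
  intro μ₀ X
  -- the member letters
  have hd : (PV 2 ℓ m K hd3 hL).d = 3 := rfl
  have hLdef : (PV 2 ℓ m K hd3 hL).L = ℓ + 1 := rfl
  have hk : K - n ≤ (PV 2 ℓ m K hd3 hL).m + (PV 2 ℓ m K hd3 hL).K := hkw ℓ hL m n K
  have h3 : 3 ≤ (PV 2 ℓ m K hd3 hL).L ^ (K - n) := by
    rw [hLdef]
    have : ℓ + 1 ≤ (ℓ + 1) ^ (K - n) := Nat.le_self_pow (by omega) _
    omega
  have e₁ : (((PV 2 ℓ m K hd3 hL).L ^ (K - n) : ℕ) : ℝ) = (((PV 2 ℓ m K hd3 hL).L : ℕ) : ℝ) ^ (K - n) := Nat.cast_pow _ _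
  have e₂ : (((PV 2 ℓ m K hd3 hL).L ^ (K - n) : ℕ) : ℝ) = ((ℓ + 1 : ℕ) : ℝ) ^ (K - n) := by rw [hLdef]; exact Nat.cast_pow _ _
  have h3r : (3 : ℝ) ≤ (((PV 2 ℓ m K hd3 hL).L : ℕ) : ℝ) ^ (K - n) := by rw [← e₁]; exact_mod_cast h3
  have hℓk1 : (1 : ℝ) ≤ ((ℓ + 1 : ℕ) : ℝ) ^ (K - n) := one_le_pow₀ (by exact_mod_cast (show 1 ≤ ℓ + 1 by omega))
  -- the package
  obtain ⟨ψ, g, c₁, c₂, ψt, hid1, hid2, hψt, hN2, hH, hS, hN3, hN4, hE2⟩ :=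
    HP (PV 2 ℓ m K hd3 hL) hd (K - n) hk h3 x₀ μ₀ (fun κ z => unitsField (toUField W) ⟨z, κ⟩) Fr hU hFr A₀ A₁ A₂ hA₀0 hA₁0 hA₂0 h1 h1' h2 X ω (Real.exp (11 * κ)) hωS
  refine ⟨ψ, g, c₁, c₂, ψt, _, _, _, _, _, hid1, hid2, hψt, hN2, hH, hS, hN3, hN4, hE2, ?_, ?_⟩
  · -- the size of `B`
    rw [e₂]
    exact junk_B_le hℓk1 hC hA₁0 hA₂0 hA₀ hA₁ hA₂
  · -- the gen-0 half of `htot`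
    intro A hA0 hA
    have hcard := card_ball_le (P := PV 2 ℓ m K hd3 hL) x₀ ((PV 2 ℓ m K hd3 hL).L ^ (K - n))
    exact gen0_total_le (d := (PV 2 ℓ m K hd3 hL).d) hd 2 (ℓ₁ := (((PV 2 ℓ m K hd3 hL).L ^ (K - n) : ℕ) : ℝ)) (ℓ := (((PV 2 ℓ m K hd3 hL).L : ℕ) : ℝ) ^ (K - n)) e₁ h3r
      (C := C) (α := c35 * a₅ * Real.exp (c35 * a₅) * (1 + 4 * (c35 * a₅ * Real.exp (c35 * a₅)))) (Ω := Real.exp (11 * κ))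
      (W₀ := 5 / κ * Real.sqrt (5 / κ) * (((ℓ + 1 : ℕ) : ℝ) ^ (K - n)) * Real.sqrt (((ℓ + 1 : ℕ) : ℝ) ^ (K - n))) (w := 5 / κ * Real.sqrt (5 / κ)) (A := A) (cA := cA)
      (rX := Real.sqrt (∑ j : Fin 2, ∑ k' : Fin 2, ‖X j k'‖ ^ 2)) (nX := ‖X‖)
      (card := (((univ.filter fun z : Site (PV 2 ℓ m K hd3 hL) 0 => Site.tdist z x₀ ≤ 9 * (PV 2 ℓ m K hd3 hL).L ^ (K - n))).card : ℝ))
      (A₀ := A₀) (A₁ := A₁) (A₂ := A₂) hC hΩ0 hw0 (Real.sqrt_nonneg _) (norm_nonneg X) (norm_le_sqrt_hs X) hA₀0 hA₁0 hA₂0 hA₀ hA₁ hA₂ le_rfl hA0 hA hcard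

end Summit.QuantumFields.YangMills.Theorems.Prop7CovKernelMemberGen0

end
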